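import Literature.Probability.RandomPlanarGeometry.SLEKappaRho
import Literature.Probability.RandomPlanarGeometry.SmoothArcApproximation
import Literature.Probability.RandomPlanarGeometry.EllipseHulls
import Literature.Probability.RandomPlanarGeometry.LoewnerHullConnected
import Literature.Probability.RandomPlanarGeometry.HullDecomposition
import Literature.Probability.RandomPlanarGeometry.LoewnerMapProofs
import Literature.Probability.RandomPlanarGeometry.LocalMartingaleProofs
import HarnessLib

/-!
# [LSW] Theorem 8.4, the avoidance formula `P[K ∩ A = ∅] = Φ_A'(0)^α`: decomposition into its printed leaves

Level 5 of the decomposition of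
`Literature.Probability.RandomPlanarGeometry.IsRestrictionMeasure.eq_five_eighths_of_simple`
(plan in `SLEKappaRho`), for the named fact
`Literature.Probability.RandomPlanarGeometry.SLEKappaRho.measure_fill_disjoint` (`SLEKappaRho`):
for `ρ > −2`, an SLE(8/3, ρ) driving pair `(O, W)`, `A ∈ 𝒬₊` with restriction data `(Φ_A, d)`,
`P[F^{ℝ₊}_ℍ(cl K_∞) ∩ A = ∅] = d^α`, `α = (3ρ + 10)(2 + ρ)/32`, after

* G. F. Lawler, O. Schramm, W. Werner, *Conformal restriction: the chordal case*, J. Amer. Math.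
  Soc. **16** (2003) 917–955, arXiv:math/0209343 (**[LSW]**), Thm. 8.4 and §8.4 "Proof of
  Theorem 8.4" (Lemma 8.9, Lemma 8.10 and the end of the proof), with Lemma 6.2, Lemma 6.3,
  Lemma 8.3, Lemma 2.1 and the end of the proof of Thm. 7.3 (§7.2).

The printed proof (§8.4): "Fix `ρ > −2` and let `c = 3ρ/8` and `b = ρ(4 + 3ρ)/32`. […] Let
`A ∈ 𝒬₊` be a given smooth hull, and let `Φ = Φ_A`, `T = T_A`, and `h_t` be as in §5 and define
(for `t < T`), `M_t := h_t'(W_t)^{5/8} h_t'(O_t)^b [(h_t(W_t) − h_t(O_t))/(W_t − O_t)]^c`.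
**Lemma 8.9.** `(M_t, t < T)` is a local martingale [Itô's formula for `h_t(W_t)`, `h_t'(W_t)`,
`h_t(O_t)`, `h_t'(O_t)`; "tedious but straightforward"]. **Lemma 8.10.** There exists `ε > 0`
such that `M_t ≤ h_t'(W_t)^ε` for all `t < T`. In particular, `M_t ≤ 1` [through (8.2):
`h_t'(W_t) ≤ (h_t(W_t) − h_t(O_t))/(W_t − O_t) ≤ h_t'(O_t) ≤ 1`]. **End of the proof.** […] if
`T < ∞`, then `K_T ∩ A ⊄ ℝ` [Lemma 8.3: `K_∞ ∩ (0, ∞) = ∅`], Lemma 6.3 shows that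
`lim_{t → T−} h_t'(W_t) = 0`, and Lemma 8.10 implies that `lim_{t → T−} M_t = 0` if `T < ∞`. Let
us now suppose that `T = ∞`. Lemma 6.2 shows that a.s. on the event `T = ∞`,
`lim_{r → ∞} h'_{T_r}(W_{T_r}) = 1`. By (8.2), it follows that `lim_{r → ∞} M_{T_r} = 1`. Hence,
since `M_t` converges a.s. and in `L¹` when `t → T`, it follows that the limit is `1_{T = ∞}` and
`P[K_∞ ∩ A = ∅] = M_0 = Φ_A'(0)^α`. It remains to prove that a.s. `K̄_∞ ∩ A = ∅` iff
`K_∞ ∩ A = ∅`. As `K_t` is closed for each `t`, the proof of this fact is essentially identical to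
the argument showing that `⋂_{s>0} Ξ̄_s = ∅` given at the end of the proof of Theorem 7.3."

This file separates the printed inputs of that proof and PROVES its deductions, in the
vocabulary of the tree (the closed hulls `Loewner.closedHull`, slid hulls `Loewner.slidHull`,
exit times `Loewner.IsExitTime` and hitting times `Loewner.IsHullHitTime` of
`SLERestrictionLemmas`; the specification pattern `IsRestrictionMartingale` of
`SLERestrictionMartingale` for [LSW] Prop. 5.2/5.3):

* `Literature.Probability.RandomPlanarGeometry.Loewner.hullHitTime W A` — `T_A ∈ [0, ∞]` as a
  `WithTop ℝ≥0`-valued time (PROVED API: `= ⊤` iff never hit, finite values are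
  `IsHullHitTime`s, `T_A > 0` for `A` closed off the driving point, and exit times `T(r)` exist
  at arbitrarily large times when `K_∞` is unbounded);
* `Literature.Probability.RandomPlanarGeometry.SLEKappaRho.integral_inv_eq` — NAMED FACT, [LSW]
  §8.3: "`∫₀ᵗ du/Z_u = (Z_t − √κ B_t)/(ρ + 2) < ∞` for all `t ≥ 0`" (the integrated Bessel
  equation of `Z = W − O`), from which the a.s. CONTINUITY of the paths of `(O, W)` is PROVED
  (`IsSLEKappaRhoPair.ae_continuous`; the tree's `O_t = −2 ∫₀ᵗ du/Z_u` is an interval integral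
  with junk value `0` where `1/Z` is not integrable);
* `Literature.Probability.RandomPlanarGeometry.SLEKappaRho.IsOneSidedMartingale ρ A W M` and the
  NAMED FACT `SLEKappaRho.exists_isOneSidedMartingale` — **Lemmas 8.9 and 8.10** with the
  convergence clause of the end of the proof, packaged as the properties of `M` the proof
  consumes (bounded `𝓕ᵂ`-martingale, `M_0 = Φ_A'(0)^α`, `h_t'(W_t)^N ≤ M_t ≤ h_t'(W_t)^ε` before
  `T_A`, frozen after `T_A`, convergent on `{T_A = ∞}`), for SMOOTH `A ∈ 𝒬₊` as printed
  (non-vacuity: `SLEKappaRho.isOneSidedMartingale_empty`);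
* the last paragraph quoted above — a.s. `cl K_∞ ∩ A = ∅ ↔ K_∞ ∩ A = ∅`, `K_∞ = ⋃ K_t` (closed
  hulls), `A` smooth in `𝒬₊` — is a step of this very proof, not a separate published result: it
  enters the assembly below as an explicit CLOSURE HYPOTHESIS (`hcl`, per hull in
  `SLEKappaRho.measure_fill_disjoint_of_isSmoothHull`, for all smooth `A ∈ 𝒬₊` in
  `SLEKappaRho.measure_fill_disjoint_of_leaves`) and is PROVED from the other leaves in
  `SLEKappaRhoRestrictionProofs` (`SLEKappaRho.ae_disjoint_closure_iff_of_leaves`, by the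
  probability estimate of the end of the proof of Thm. 7.3 run with the outer smooth hulls `E_δ`
  of Lemma 2.1), which closes the assembly (`SLEKappaRho.measure_fill_disjoint_of_five_leaves`);
* PROVED deductions: `SLEKappaRho.IsOneSidedMartingale.ae_tendsto_one` (on `{T_A = ∞}`,
  `M → 1`, from Lemma 6.2 = `Loewner.restrictionDeriv_exitTime_gt` at the exit times, which exist
  by Lemma 8.3 (4) = `SLEKappaRho.not_isBounded_hullUnion`), `.ae_eq_zero_of_le` (on `{T_A < ∞}`,
  `M = 0` after `T_A`, from Lemma 6.3 = `IsSmoothHull.restrictionDerivVanishesAtHit`, its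
  hypothesis "`K_T ∩ A ∩ ℝ = ∅`" being Lemma 8.3 (2) = `SLEKappaRho.swallowingTime_ofReal`),
  `.measure_hullHitTime_eq_top_of_tendsto` (`P[T_A = ∞] = M_0 = Φ_A'(0)^α` by dominated
  convergence), assembled in `SLEKappaRho.measure_hullHitTime_eq_top`;
* PROVED identification of the events: the filling is irrelevant for `+`-hulls
  (`IsPlusHull.disjoint_leftFilling_iff`: every component of `A` reaches `(0, ∞)` inside `A`),
  `{F^{ℝ₊}_ℍ(cl K_∞ᵒ) ∩ A = ∅} = {T_A = ∞}` on the sample paths where Lemma 8.3 (2) and the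
  closure statement hold (`IsPlusHull.disjoint_sleKappaRhoFill_iff`; the tree's `K_tᵒ ⊆ ℍ` and
  [LSW]'s `K_t ⊆ ℍ̄` differ by swallowed real points, a.s. all in `(−∞, 0]`), hence Thm. 8.4 for
  smooth hulls given the closure hypothesis (`SLEKappaRho.measure_fill_disjoint_of_isSmoothHull`);
* PROVED: **the hulls do not accumulate on `(0, ∞)`** (`SLEKappaRho.ae_ofReal_notMem_closure_hullUnion`,
  implicit in Thm. 8.4's "`K ∈ Ω₊`", i.e. `K ∩ ℝ = (−∞, 0]`), by the argument of the end of the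
  proof of Thm. 7.3 ("`1 − Φ_D'(0) = O(ε²)` … Thus, a.s., `Ξ̄ ∩ [1,2] = ∅`") run with the tree's
  half-ellipse hulls (`EllipseHulls`: `Φ'_{B(a,b;ρ)}(0) → 1` as `ρ → 1`) and smooth hulls around
  them from Lemma 2.1 (`IsPlusHull.exists_antitone_isSmoothHull_holds`);
* PROVED: the passage from smooth hulls to all of `𝒬₊` by Lemma 2.1 (as in the proof of Thm. 6.1,
  "By Proposition 3.3, it suffices to consider the case where `A` is a smooth hull"), and the
  assembly `Literature.Probability.RandomPlanarGeometry.SLEKappaRho.measure_fill_disjoint_of_leaves`: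
  `SLEKappaRho.measure_fill_disjoint` follows from SIX named facts — the two of this file,
  Lemma 6.2 (`Loewner.restrictionDeriv_exitTime_gt`, general driving functions), Lemma 6.3
  (`IsSmoothHull.restrictionDerivVanishesAtHit`), Lemma 8.3 (2)–(3) and (4)
  (`SLEKappaRho.swallowingTime_ofReal`, `SLEKappaRho.not_isBounded_hullUnion`) — and the closure
  hypothesis, the discharged inputs (Lemma 2.1, existence/uniqueness of `Φ_A` and `Φ_A'(0)`,
  Kolmogorov's extension for the pre-Wiener measure, Lawler's Lemma 4.13 on the size of hulls)
  being fed by their proofs; `SLEKappaRhoRestrictionProofs` then proves the closure hypothesis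
  and Lemma 8.3 (4) from the remaining five named facts.

Not here: the Itô computation of Lemma 8.9 and the Loewner-chain argument of Lemma 8.10 (inside
the named fact), the proof of the closure statement (`SLEKappaRhoRestrictionProofs`), [LSW]
Lemma 8.3 (1) (scaling), the measurable `Ω₊`-valued version of `K`
(`SLEKappaRho.exists_measurable_fill_version`).
-/

noncomputable section

open Set Filter Topology MeasureTheory Metric
open UpperHalfPlane (upperHalfPlaneSet)
open scoped NNReal ENNReal
open Literature.Analysis.FunctionSpaces (IsBesselProcess IsSquaredBesselProcess IsStrongSolution
  IsItoProcess)
open Literature.Probability.Process (preWienerMeasure brownian continuous_brownian)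

namespace Literature.Probability.RandomPlanarGeometry

/-! ### The hitting time `T_A = inf{t : K_t ∩ A ≠ ∅}` of a hull by the closed Loewner hulls -/

namespace Loewner

variable {W : ℝ≥0 → ℝ} {A : Set ℂ}

/-- **The hitting time `T = T_A = inf{t ≥ 0 : K_t ∩ A ≠ ∅} ∈ [0, ∞]`** of the set `A` by the
closed hulls `K_t ⊆ ℍ̄` of the chain driven by `W` ([LSW] §5: "let `T = T_A = inf{t : K_t ∩ A ≠ ∅}`";
§8.4: "let `Φ = Φ_A`, `T = T_A`"), as an element of `WithTop ℝ≥0` (`⊤` when `A` is never hit).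
The tree's predicate `Loewner.IsHullHitTime W A τ` (`SLERestrictionLemmas`) says "`τ = T_A`"
for finite `τ` (`isHullHitTime_of_hullHitTime_eq`).
[cite: LawlerSchrammWerner2003Restriction, §5 (T_A) and §8.4] -/
def hullHitTime (W : ℝ≥0 → ℝ) (A : Set ℂ) : WithTop ℝ≥0 :=
  ⨅ (t : ℝ≥0) (_ : ¬ Disjoint (closedHull W t) A), (t : WithTop ℝ≥0)

/-- `T_A ≤ t` as soon as `K_t` meets `A`. [folklore] -/
theorem hullHitTime_le {t : ℝ≥0} (h : ¬ Disjoint (closedHull W t) A) :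
    hullHitTime W A ≤ t :=
  iInf₂_le t h

/-- `T_A = ∞` iff no closed hull ever meets `A`. [folklore] -/
theorem hullHitTime_eq_top_iff : hullHitTime W A = ⊤ ↔ ∀ t, Disjoint (closedHull W t) A := by
  simp only [hullHitTime, iInf_eq_top, WithTop.coe_ne_top, imp_false, not_not]

/-- Before `T_A` the closed hulls miss `A`. [folklore] -/
theorem disjoint_closedHull_of_lt_hullHitTime {s : ℝ≥0} (h : (s : WithTop ℝ≥0) < hullHitTime W A) :
    Disjoint (closedHull W s) A := by
  by_contra hs
  exact (hullHitTime_le hs).not_gt h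

/-- If `T_A < s` then some closed hull `K_t`, `t < s`, meets `A`. [folklore] -/
theorem exists_not_disjoint_of_hullHitTime_lt {s : WithTop ℝ≥0} (h : hullHitTime W A < s) :
    ∃ t : ℝ≥0, (t : WithTop ℝ≥0) < s ∧ ¬ Disjoint (closedHull W t) A := by
  simp only [hullHitTime, iInf_lt_iff] at h
  obtain ⟨t, ht, hts⟩ := h
  exact ⟨t, hts, ht⟩

/-- A finite value `τ` of `T_A` is a hull hitting time in the sense of `Loewner.IsHullHitTime`:
the closed hulls miss `A` before `τ` and meet it after `τ` (they increase). [folklore] -/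
theorem isHullHitTime_of_hullHitTime_eq {τ : ℝ≥0} (h : hullHitTime W A = τ) :
    IsHullHitTime W A τ := by
  refine ⟨fun s hs ↦ disjoint_closedHull_of_lt_hullHitTime (by rw [h]; exact_mod_cast hs),
    fun s hs hdisj ↦ ?_⟩
  obtain ⟨t, hts, ht⟩ := exists_not_disjoint_of_hullHitTime_lt (s := s) (by rw [h]; exact_mod_cast hs)
  exact ht (hdisj.mono_left (closedHull_mono W (le_of_lt (by exact_mod_cast hts))))

/-- If `K_u` misses `A` then `T_A ≥ u`. [folklore] -/
theorem le_hullHitTime_of_disjoint {u : ℝ≥0} (h : Disjoint (closedHull W u) A) :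
    (u : WithTop ℝ≥0) ≤ hullHitTime W A := by
  refine le_iInf₂ fun t ht ↦ ?_
  by_contra hlt
  push Not at hlt
  exact ht (h.mono_left (closedHull_mono W (le_of_lt (by exact_mod_cast hlt))))

/-- **Small hulls miss a closed set off the driving point**: for a continuous driving function
with `W_0 = 0` and a closed `A ∌ 0`, some closed hull `K_u`, `u > 0`, misses `A` (the closed
hull at time `u` lies within `sup_{s ≤ u}|W_s| + 4√u` of `0`, Lawler's Lemma 4.13,
`norm_sub_driving_le_of_swallowingTime_le`). [folklore] -/
theorem exists_pos_disjoint_closedHull (hW : Continuous W) (hW0 : W 0 = 0) (hA : IsClosed A)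
    (h0 : (0 : ℂ) ∉ A) : ∃ u : ℝ≥0, 0 < u ∧ Disjoint (closedHull W u) A := by
  obtain ⟨δ, hδ, hball⟩ := Metric.isOpen_iff.1 hA.isOpen_compl 0 h0
  obtain ⟨η, hη, hηW⟩ := Metric.continuous_iff.1 hW 0 (δ / 3) (by positivity)
  set u : ℝ≥0 := ⟨min (η / 2) ((δ / 12) ^ 2), by positivity⟩ with hu
  have hu_pos : (0 : ℝ) < u := by
    show (0 : ℝ) < min (η / 2) ((δ / 12) ^ 2)
    positivity
  have hu_eta : (u : ℝ) < η := by
    show min (η / 2) ((δ / 12) ^ 2) < η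
    exact (min_le_left _ _).trans_lt (by linarith)
  have hu_sq : Real.sqrt u ≤ δ / 12 := by
    have : (u : ℝ) ≤ (δ / 12) ^ 2 := min_le_right _ _
    calc Real.sqrt u ≤ Real.sqrt ((δ / 12) ^ 2) := Real.sqrt_le_sqrt this
      _ = δ / 12 := Real.sqrt_sq (by positivity)
  refine ⟨u, by exact_mod_cast hu_pos, Set.disjoint_left.2 fun z hz hzA ↦ ?_⟩
  have hS : ∀ s : ℝ≥0, s ≤ u → |W s - W 0| ≤ δ / 3 := by
    intro s hs
    have hds : dist s 0 < η := by
      rw [NNReal.dist_eq, NNReal.coe_zero, sub_zero, NNReal.abs_eq]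
      exact lt_of_le_of_lt (by exact_mod_cast hs) hu_eta
    have := hηW s hds
    rw [Real.dist_eq] at this
    exact this.le
  apply hball _ hzA
  rw [mem_ball, dist_zero_right]
  rcases eq_or_ne z (W 0 : ℂ) with hz0 | hz0
  · rw [hz0, hW0]
    simpa using hδ
  · have h := norm_sub_driving_le_of_swallowingTime_le hW hS hz0 hz.2
    rw [hW0, Complex.ofReal_zero, sub_zero] at h
    linarith

/-- **`T_A > 0`** for a continuous driving function with `W_0 = 0` and a closed `A ∌ 0`.
[folklore] -/
theorem hullHitTime_pos (hW : Continuous W) (hW0 : W 0 = 0) (hA : IsClosed A) (h0 : (0 : ℂ) ∉ A) :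
    0 < hullHitTime W A := by
  obtain ⟨u, hu, hdisj⟩ := exists_pos_disjoint_closedHull hW hW0 hA h0
  exact lt_of_lt_of_le (by exact_mod_cast hu) (le_hullHitTime_of_disjoint hdisj)

/-- **Exit times exist and are unbounded when `K_∞` is unbounded**: for a continuous driving
function whose union of hulls `K_∞ = ⋃ K_t` is unbounded, for every `r₀` and `s₀` there is an
exit time `t = T(r) ≥ s₀` of a disc of radius `r ≥ r₀` (the set `{s : K_s ⊂ r𝕌}` is a nonempty
bounded initial segment for `r` larger than the size of `K_{s₀}`; its supremum is `T(r)`,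
`isExitTime_csSup`). [cite: LawlerSchrammWerner2003Restriction, Lemma 6.2 (T(r))] -/
theorem exists_isExitTime_ge (hW : Continuous W) (hunb : ¬ Bornology.IsBounded (hullUnion W))
    (r₀ : ℝ) (s₀ : ℝ≥0) : ∃ (r : ℝ) (t : ℝ≥0), r₀ ≤ r ∧ s₀ ≤ t ∧ IsExitTime W r t := by
  obtain ⟨r₁, hr₁⟩ := (isBounded_closedHull hW s₀).subset_ball 0
  set r : ℝ := max r₀ r₁ with hr
  -- a hull point outside the disc of radius `r`
  obtain ⟨s₁, z, hz, hzr⟩ : ∃ (s₁ : ℝ≥0) (z : ℂ), z ∈ hull W s₁ ∧ r ≤ ‖z‖ := by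
    by_contra h
    push Not at h
    refine hunb ((isBounded_ball (x := (0 : ℂ)) (r := r)).subset ?_)
    rintro z hz
    obtain ⟨s, hs⟩ := mem_iUnion.1 hz
    rw [mem_ball, dist_zero_right]
    exact h s z hs
  set S : Set ℝ≥0 := {s | closedHull W s ⊆ ball 0 r} with hS
  have hs₀ : s₀ ∈ S := hr₁.trans (ball_subset_ball (le_max_right _ _))
  have hbdd : BddAbove S := by
    refine ⟨s₁, fun s hs ↦ le_of_lt ?_⟩
    by_contra hle
    push Not at hle
    have := hs (hull_subset_closedHull W s (hull_mono W hle hz))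
    rw [mem_ball, dist_zero_right] at this
    exact lt_irrefl _ (hzr.trans_lt this)
  exact ⟨r, sSup S, le_max_left _ _, le_csSup hbdd hs₀, isExitTime_csSup hS ⟨s₀, hs₀⟩ hbdd⟩

end Loewner

/-! ### The filling is irrelevant for the avoidance of `+`-hulls -/

variable {A : Set ℂ}

/-- **`F^{ℝ₊}_ℍ(C)` misses a `+`-hull `A` iff `C` does**: every point of `A` is joined inside
`A ⊆ ℍ̄ ∖ C` to a point of `A ∩ (0, ∞)` (every component of a `*`-hull meets `ℝ ∖ {0}`,
`IsStarHull.exists_real_mem_connectedComponentIn`; real points of a `+`-hull are positive), so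
lies in the component of `ℍ̄ ∖ C` of a point of `[0, ∞)`, off the filling; conversely
`C ∩ ℍ̄ ⊆ F^{ℝ₊}_ℍ(C)` and `A ⊆ ℍ̄`. [folklore] -/
theorem IsPlusHull.disjoint_leftFilling_iff (hA : IsPlusHull A) (C : Set ℂ) :
    Disjoint (leftFilling C) A ↔ Disjoint C A := by
  have hAim : ∀ z ∈ A, 0 ≤ z.im := fun z hz ↦ hA.1.isBoundedHull.im_nonneg hz
  constructor
  · intro h
    refine Set.disjoint_left.2 fun z hzC hzA ↦ ?_
    exact Set.disjoint_left.1 h (inter_subset_leftFilling C ⟨hzC, hAim z hzA⟩) hzA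
  · intro h
    refine Set.disjoint_left.2 fun z hzF hzA ↦ ?_
    obtain ⟨x, hx0, hx⟩ := hA.1.exists_real_mem_connectedComponentIn
      hA.1.isBoundedHull.isConnected_union_im_nonpos hzA
    have hxA : (x : ℂ) ∈ A := connectedComponentIn_subset _ _ hx
    have hxpos : 0 < x := hA.2 x hxA
    -- the component of `z` in `A` lies in `ℍ̄ ∖ C` and contains `x`
    have hsub : connectedComponentIn A z ⊆ {z : ℂ | 0 ≤ z.im} \ C := fun w hw ↦
      ⟨hAim w (connectedComponentIn_subset _ _ hw),
        fun hwC ↦ Set.disjoint_left.1 h hwC (connectedComponentIn_subset _ _ hw)⟩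
    have hzx : z ∈ connectedComponentIn ({z : ℂ | 0 ≤ z.im} \ C) x := by
      have h1 : connectedComponentIn A z ⊆ connectedComponentIn ({z : ℂ | 0 ≤ z.im} \ C) x :=
        isPreconnected_connectedComponentIn.subset_connectedComponentIn hx hsub
      exact h1 (mem_connectedComponentIn hzA)
    exact (mem_leftFilling_iff.1 hzF).2 x hxpos.le hzx


/-! ### Continuity of the SLE(κ, ρ) driving pair ([LSW] §8.3: `∫₀ᵗ du/Z_u < ∞`) -/

/-- NAMED FACT — **the integrated Bessel equation of `Z = W − O`** ([LSW] §8.3, definition of SLE(κ, ρ), right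
after the definition of `Z_t` as "`√κ` times a `d`-dimensional Bessel process where
`d = 1 + 2(ρ + 2)/κ`. It is well-known (e.g., [RY]) that this process is well-defined (for all
`ρ > −2` and all `t ≥ 0`)"): "Note also that `∫₀ᵗ du/Z_u = (Z_t − √κ B_t)/(ρ + 2) < ∞` for all
`t ≥ 0`." For `κ > 0`, `ρ > −2` and an SLE(κ, ρ) driving pair `(O, W)` (`IsSLEKappaRhoPair`,
`Z = W − O = √κ X` for the `d`-dimensional Bessel process `X` of the construction): almost
surely, for every `t`, `u ↦ 1/Z_u` is integrable on `[0, t]` and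
`∫₀ᵗ du/Z_u = (Z_t − √κ B_t)/(ρ + 2)`. (This is the Bessel stochastic differential equation
`X_t = B_t + ((d − 1)/2) ∫₀ᵗ du/X_u` for `d > 1`, Revuz–Yor Ch. XI §1, which the tree's
`IsBesselProcess` — the square root of a squared Bessel process — does not record.)
[cite: LawlerSchrammWerner2003Restriction, §8.3 (definition of SLE(κ, ρ): ∫₀ᵗ du/Z_u = (Z_t − √κ B_t)/(ρ+2) < ∞)] -/
def SLEKappaRho.integral_inv_eq : Prop :=
  ∀ {κ : ℝ≥0} {ρ : ℝ} {O W : ℝ≥0 → (ℝ≥0 → ℝ) → ℝ}, 0 < κ → -2 < ρ → IsSLEKappaRhoPair κ ρ O W →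
    ∀ᵐ ω ∂preWienerMeasure, ∀ t : ℝ≥0,
      IntervalIntegrable (fun u : ℝ ↦ (W u.toNNReal ω - O u.toNNReal ω)⁻¹) volume 0 t ∧
        ∫ u in (0 : ℝ)..t, (W u.toNNReal ω - O u.toNNReal ω)⁻¹ =
          ((W t ω - O t ω) - Real.sqrt κ * brownian t ω) / (ρ + 2)

namespace IsSLEKappaRhoPair

variable {κ : ℝ≥0} {ρ : ℝ} {O W : ℝ≥0 → (ℝ≥0 → ℝ) → ℝ}

/-- **The paths of an SLE(κ, ρ) driving pair are a.s. continuous**: by the integrated Bessel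
equation (`SLEKappaRho.integral_inv_eq`), a.s. `O_t = −2 ∫₀ᵗ du/Z_u = −2(Z_t − √κ B_t)/(ρ + 2)`
for all `t`, where `Z = √κ X` has continuous paths a.s. (`X` is the square root of an Itô
process) and `B` is the canonical Brownian motion; and `W = Z + O`.
[cite: LawlerSchrammWerner2003Restriction, §8.3 (definition of SLE(κ, ρ): ∫₀ᵗ du/Z_u = (Z_t − √κ B_t)/(ρ+2) < ∞)] -/
theorem ae_continuous (hint : SLEKappaRho.integral_inv_eq) (hκ : 0 < κ) (hρ : -2 < ρ)
    (h : IsSLEKappaRhoPair κ ρ O W) :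
    ∀ᵐ ω ∂preWienerMeasure, Continuous (fun t ↦ W t ω) ∧ Continuous (fun t ↦ O t ω) := by
  obtain ⟨X, ⟨Z, hZ, hXZ⟩, hO, hW⟩ := h
  have hZc := (IsStrongSolution.isItoProcess hZ).ae_continuous
  filter_upwards [hint hκ hρ ⟨X, ⟨Z, hZ, hXZ⟩, hO, hW⟩, hZc] with ω hI hZω
  have hXc : Continuous fun t ↦ X t ω := by
    have : (fun t ↦ X t ω) = fun t ↦ Real.sqrt (Z t ω) := funext fun t ↦ hXZ t ω
    rw [this]
    exact Real.continuous_sqrt.comp hZω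
  have hρ2 : (ρ + 2) ≠ 0 := by linarith
  -- `O_t = -2 (√κ X_t - √κ B_t)/(ρ + 2)` for all `t`
  have hOeq : ∀ t : ℝ≥0, O t ω =
      -2 * ((Real.sqrt κ * X t ω - Real.sqrt κ * brownian t ω) / (ρ + 2)) := by
    intro t
    have h1 := (hI t).2
    have h2 : (fun u : ℝ ↦ (W u.toNNReal ω - O u.toNNReal ω)⁻¹) =
        fun u : ℝ ↦ (Real.sqrt κ * X u.toNNReal ω)⁻¹ := by
      funext u
      rw [hW u.toNNReal ω]
      ring_nf
    rw [h2, hW t ω] at h1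
    rw [hO t ω, h1]
    ring_nf
  have hOc : Continuous fun t ↦ O t ω := by
    have : (fun t ↦ O t ω) =
        fun t ↦ -2 * ((Real.sqrt κ * X t ω - Real.sqrt κ * brownian t ω) / (ρ + 2)) :=
      funext hOeq
    rw [this]
    exact continuous_const.mul
      (((continuous_const.mul hXc).sub (continuous_const.mul (continuous_brownian ω))).div_const _)
  refine ⟨?_, hOc⟩
  have : (fun t ↦ W t ω) = fun t ↦ Real.sqrt κ * X t ω + O t ω := funext fun t ↦ hW t ω
  rw [this]
  exact (continuous_const.mul hXc).add hOc

end IsSLEKappaRhoPair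

/-! ### The one-sided restriction martingale `M_t` of [LSW] §8.4 (Lemmas 8.9, 8.10) -/

/-- **Specification of the martingale `M` of [LSW] §8.4 for SLE(8/3, ρ) and the hull `A`.**
§8.4: "Fix `ρ > −2` and let `c = 3ρ/8` and `b = ρ(4 + 3ρ)/32`. Let `(O_t, W_t)` generate
an SLE(8/3, ρ) process […]. Let `A ∈ 𝒬₊` be a given smooth hull, and let `Φ = Φ_A`, `T = T_A`,
and `h_t` be as in §5 and define (for `t < T`),
`M_t := h_t'(W_t)^{5/8} h_t'(O_t)^b [(h_t(W_t) − h_t(O_t))/(W_t − O_t)]^c`. […] **Lemma 8.9.**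
`(M_t, t < T)` is a local martingale. **Lemma 8.10.** There exists `ε > 0` such that
`M_t ≤ h_t'(W_t)^ε` for all `t < T`. In particular, `M_t ≤ 1`", with, in the proof of Lemma 8.10,
(8.2): "`h_t'(W_t) ≤ (h_t(W_t) − h_t(O_t))/(W_t − O_t) ≤ h_t'(O_t) ≤ 1`" (so that each factor of
`M_t` lies in `[h_t'(W_t), 1]` and `M_t ≥ h_t'(W_t)^N` for some `N > 0`; end of the proof: "By
(8.2), it follows that `lim_{r → ∞} M_{T_r} = 1`" from `h'_{T_r}(W_{T_r}) → 1`), and, at the end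
of the proof of Thm. 8.4 (§8.4): "since `M_t` converges a.s. and in `L¹` when `t → T` […]
`P[K_∞ ∩ A = ∅] = M_0 = Φ_A'(0)^α`." Packaged — exactly as the tree's `IsRestrictionMartingale`
packages [LSW] Prop. 5.2/5.3 for SLE_{8/3} (`SLERestrictionMartingale`) — as the properties of the
real process `M` on the canonical space `(ℝ≥0 → ℝ, preWienerMeasure)` that the proof of Thm. 8.4
consumes, with `h_t'(W_t) = Φ'_{A_t − W_t}(0)` the restriction derivative of the slid hull
`A_t − W_t` (`Loewner.slidHull`, `HasRestrictionDeriv`) of the driving function `t ↦ W_t(ω)` and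
`T = T_A` the hitting time of `A` by its closed hulls (`Loewner.hullHitTime`):

* `0 ≤ M_t ≤ 1` (Lemma 8.10; `M` is a product of real powers of numbers in `(0, 1]`);
* `M` is a martingale for the Brownian filtration (Lemma 8.9 with boundedness; extended past
  `T` by its left limit `M_T`, as `Y` in `IsRestrictionMartingale`);
* a.s. `M_0 = Φ_A'(0)^α`, `α = (3ρ + 10)(2 + ρ)/32` (`sleKappaRhoExponent`), for all restriction
  data of `A`;
* for some constants `ε, N > 0`: a.s., for all `t < T`, the slid hull has restriction data
  with derivative `e = h_t'(W_t) ∈ (0, 1]` and `e^N ≤ M_t ≤ e^ε` (Lemma 8.10 and (8.2));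
* a.s., from `T < ∞` on `M` is frozen at its left limit, and on `{T = ∞}` `lim_{t → ∞} M_t`
  exists ("`M_t` converges a.s. […] when `t → T`").
[cite: LawlerSchrammWerner2003Restriction, §8.4: Lemma 8.9, Lemma 8.10 with (8.2), and the end of the proof of Thm. 8.4] -/
structure SLEKappaRho.IsOneSidedMartingale (ρ : ℝ) (A : Set ℂ) (W M : ℝ≥0 → (ℝ≥0 → ℝ) → ℝ) :
    Prop where
  /-- `0 ≤ M_t ≤ 1`. -/
  mem_Icc : ∀ t ω, M t ω ∈ Icc (0 : ℝ) 1
  /-- `M` is an `𝓕ᵂ`-martingale under the pre-Wiener measure. -/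
  martingale : Martingale M brownianFiltration preWienerMeasure
  /-- A.s., `M_0 = Φ_A'(0)^α` for all restriction data `(Φ, d)` of `A`. -/
  ae_apply_zero : ∀ᵐ ω ∂preWienerMeasure,
    ∀ (Φ : ConformalEquiv (upperHalfPlaneSet \ A) upperHalfPlaneSet) (d : ℝ),
      IsRestrictionMap A Φ → HasRestrictionDeriv A Φ d → M 0 ω = d ^ sleKappaRhoExponent ρ
  /-- For some `ε, N > 0`: a.s., before `T_A`, the slid hull `A_t − W_t` has restriction data
  with derivative `e = h_t'(W_t) ∈ (0, 1]` and `e ^ N ≤ M_t ≤ e ^ ε`. -/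
  ae_rpow_le_le_rpow : ∃ ε N : ℝ, 0 < ε ∧ 0 < N ∧ ∀ᵐ ω ∂preWienerMeasure, ∀ t : ℝ≥0,
    (t : WithTop ℝ≥0) < Loewner.hullHitTime (fun s ↦ W s ω) A →
      ∃ (Ψ : ConformalEquiv
          (upperHalfPlaneSet \ Loewner.slidHull (fun s ↦ W s ω) A t) upperHalfPlaneSet) (e : ℝ),
        IsRestrictionMap (Loewner.slidHull (fun s ↦ W s ω) A t) Ψ ∧
          HasRestrictionDeriv (Loewner.slidHull (fun s ↦ W s ω) A t) Ψ e ∧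
          0 < e ∧ e ≤ 1 ∧ e ^ N ≤ M t ω ∧ M t ω ≤ e ^ ε
  /-- A.s., from the hitting time `T_A < ∞` on, `M` equals its left limit at `T_A`. -/
  ae_frozen : ∀ᵐ ω ∂preWienerMeasure, ∀ τ : ℝ≥0,
    Loewner.hullHitTime (fun s ↦ W s ω) A = τ →
      ∀ t : ℝ≥0, τ ≤ t → Tendsto (fun s ↦ M s ω) (𝓝[<] τ) (𝓝 (M t ω))
  /-- A.s., if `A` is never hit (`T_A = ∞`), the limit `lim_{t → ∞} M_t` exists. -/
  ae_exists_tendsto : ∀ᵐ ω ∂preWienerMeasure, Loewner.hullHitTime (fun s ↦ W s ω) A = ⊤ →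
    ∃ c : ℝ, Tendsto (fun t ↦ M t ω) atTop (𝓝 c)

/-- NAMED FACT — **[LSW] Lemmas 8.9 and 8.10: the one-sided restriction martingale of
SLE(8/3, ρ) exists** (§8.4, quoted in `SLEKappaRho.IsOneSidedMartingale`): for
`ρ > −2`, every SLE(8/3, ρ) driving pair `(O, W)` and every SMOOTH hull `A ∈ 𝒬₊` there is a
process `M` with the properties `SLEKappaRho.IsOneSidedMartingale ρ A W M` (the process
`h_t'(W_t)^{5/8} h_t'(O_t)^b ((h_t(W_t) − h_t(O_t))/(W_t − O_t))^c` before `T_A`, frozen at its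
left limit afterwards). The printed proofs — Itô's formula for the random conformal maps `h_t`
(§5 with the drift of SLE(κ, ρ), Lemma 8.9: "tedious but straightforward") and the Loewner-chain
monotonicity argument of Lemma 8.10 — are not available in the tree (cf. the analogous named fact
`sle_exists_isRestrictionMartingale` for SLE_{8/3}, [LSW] Prop. 5.2/5.3).
[cite: LawlerSchrammWerner2003Restriction, §8.4, Lemma 8.9 and Lemma 8.10] -/
def SLEKappaRho.exists_isOneSidedMartingale : Prop :=
  ∀ {ρ : ℝ} {O W : ℝ≥0 → (ℝ≥0 → ℝ) → ℝ}, -2 < ρ → IsSLEKappaRhoPair (8 / 3) ρ O W →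
    ∀ {A : Set ℂ}, IsSmoothHull A → IsPlusHull A → ∃ M, SLEKappaRho.IsOneSidedMartingale ρ A W M

/-! ### Non-vacuity: the empty hull -/

/-- Restriction data for a set equal to `∅`, with the two-sided bounds of the specification for
the constant `1`: the identity map, `Φ_∅'(0) = 1`. [folklore] -/
theorem SLEKappaRho.exists_restrictionData_of_eq_empty {B : Set ℂ} (hB : B = ∅) (ε N : ℝ) :
    ∃ (Ψ : ConformalEquiv (upperHalfPlaneSet \ B) upperHalfPlaneSet) (e : ℝ),
      IsRestrictionMap B Ψ ∧ HasRestrictionDeriv B Ψ e ∧ 0 < e ∧ e ≤ 1 ∧ e ^ N ≤ (1 : ℝ) ∧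
        (1 : ℝ) ≤ e ^ ε := by
  subst hB
  exact ⟨restrictionMapEmpty, 1, isRestrictionMap_empty, hasRestrictionDeriv_empty, one_pos, le_rfl,
    (Real.one_rpow _).le, (Real.one_rpow _).ge⟩

/-- **The constant process `1` satisfies the specification for the empty hull** (`T_∅ = ∞`,
`∅_t − W_t = ∅`, `Φ_∅ = id`, `Φ_∅'(0) = 1`; any exponent, any driving process): the structure
`SLEKappaRho.IsOneSidedMartingale` is satisfiable. [folklore] -/
theorem SLEKappaRho.isOneSidedMartingale_empty (ρ : ℝ) (W : ℝ≥0 → (ℝ≥0 → ℝ) → ℝ) :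
    SLEKappaRho.IsOneSidedMartingale ρ ∅ W fun _ _ ↦ 1 := by
  haveI : IsProbabilityMeasure preWienerMeasure := isProbabilityMeasure_preWienerMeasure'
  have htop : ∀ ω, Loewner.hullHitTime (fun s ↦ W s ω) ∅ = ⊤ := fun ω ↦
    Loewner.hullHitTime_eq_top_iff.2 fun t ↦ Set.disjoint_empty _
  refine ⟨fun _ _ ↦ ⟨zero_le_one, le_rfl⟩, martingale_const _ _ _, ?_, ⟨1, 1, one_pos, one_pos, ?_⟩,
    ?_, ?_⟩
  · refine Eventually.of_forall fun ω Φ d hΦ hd ↦ ?_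
    have hd1 : d = 1 :=
      HasRestrictionDeriv.eq_of_isRestrictionMap IsStarHull.existsUnique_isRestrictionMap_holds
        isStarHull_empty isRestrictionMap_empty hΦ hasRestrictionDeriv_empty hd
    rw [hd1, Real.one_rpow]
  · exact Eventually.of_forall fun ω t _ ↦
      SLEKappaRho.exists_restrictionData_of_eq_empty (Loewner.slidHull_empty _ _) 1 1
  · exact Eventually.of_forall fun ω τ hτ ↦ absurd ((htop ω).symm.trans hτ) WithTop.top_ne_coe
  · exact Eventually.of_forall fun ω _ ↦ ⟨1, tendsto_const_nhds⟩

/-! ### The deduction of `P[T_A = ∞] = Φ_A'(0)^α` (end of the proof of Thm. 8.4) -/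

namespace SLEKappaRho.IsOneSidedMartingale

variable {ρ : ℝ} {A : Set ℂ} {W M : ℝ≥0 → (ℝ≥0 → ℝ) → ℝ}

/-- **`E[M_t] = Φ_A'(0)^α` for all `t`** (martingale property on the whole space and
`M_0 = Φ_A'(0)^α` a.s.). [cite: LawlerSchrammWerner2003Restriction, end of the proof of Thm. 8.4 (§8.4)] -/
theorem integral_eq [Fact Process.isProjectiveLimit_preWienerMeasure]
    (hM : IsOneSidedMartingale ρ A W M)
    {Φ : ConformalEquiv (upperHalfPlaneSet \ A) upperHalfPlaneSet} (hΦ : IsRestrictionMap A Φ)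
    {d : ℝ} (hd : HasRestrictionDeriv A Φ d) (t : ℝ≥0) :
    ∫ ω, M t ω ∂preWienerMeasure = d ^ sleKappaRhoExponent ρ := by
  have h := hM.martingale.setIntegral_eq (show (0 : ℝ≥0) ≤ t from bot_le)
    (MeasurableSet.univ (α := ℝ≥0 → ℝ))
  simp only [Measure.restrict_univ] at h
  have h0 : ∀ᵐ ω ∂preWienerMeasure, M 0 ω = d ^ sleKappaRhoExponent ρ :=
    hM.ae_apply_zero.mono fun ω hω ↦ hω Φ d hΦ hd
  rw [← h, integral_congr_ae h0, integral_const, smul_eq_mul, probReal_univ, one_mul]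

/-- **`P[T_A = ∞] = Φ_A'(0)^α` from `M_t → 1_{T_A = ∞}`**: `E[M_n] = Φ_A'(0)^α` for all `n`,
`E[M_n] → P[T_A = ∞]` by dominated convergence (`0 ≤ M ≤ 1`); the event `{T_A = ∞}` is
null-measurable as the set where the a.e. limit equals `1`.
[cite: LawlerSchrammWerner2003Restriction, end of the proof of Thm. 8.4 (§8.4)] -/
theorem measure_hullHitTime_eq_top_of_tendsto [Fact Process.isProjectiveLimit_preWienerMeasure]
    (hM : IsOneSidedMartingale ρ A W M)
    {Φ : ConformalEquiv (upperHalfPlaneSet \ A) upperHalfPlaneSet} (hΦ : IsRestrictionMap A Φ)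
    {d : ℝ} (hd : HasRestrictionDeriv A Φ d)
    (hlim : ∀ᵐ ω ∂preWienerMeasure, Tendsto (fun t ↦ M t ω) atTop
      (𝓝 (if Loewner.hullHitTime (fun s ↦ W s ω) A = ⊤ then 1 else 0))) :
    NullMeasurableSet {ω | Loewner.hullHitTime (fun s ↦ W s ω) A = ⊤} preWienerMeasure ∧
      preWienerMeasure {ω | Loewner.hullHitTime (fun s ↦ W s ω) A = ⊤} =
        ENNReal.ofReal (d ^ sleKappaRhoExponent ρ) := by
  set P : Measure (ℝ≥0 → ℝ) := preWienerMeasure with hP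
  set f : (ℝ≥0 → ℝ) → ℝ := fun ω ↦
    if Loewner.hullHitTime (fun s ↦ W s ω) A = ⊤ then 1 else 0 with hf
  have hint : ∀ n : ℕ, ∫ ω, M n ω ∂P = d ^ sleKappaRhoExponent ρ := fun n ↦
    hM.integral_eq hΦ hd n
  have hmeas : ∀ n : ℕ, AEStronglyMeasurable (M n) P := fun n ↦
    (hM.martingale.integrable _).aestronglyMeasurable
  have hlim' : ∀ᵐ ω ∂P, Tendsto (fun n : ℕ ↦ M n ω) atTop (𝓝 (f ω)) := by
    filter_upwards [hlim] with ω hω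
    exact hω.comp tendsto_natCast_atTop_atTop
  have hbound : ∀ n : ℕ, ∀ᵐ ω ∂P, ‖M n ω‖ ≤ (1 : ℝ) := fun n ↦
    Eventually.of_forall fun ω ↦ by
      rw [Real.norm_eq_abs, abs_le]
      have h := hM.mem_Icc n ω
      exact ⟨by linarith [h.1], h.2⟩
  have hDCT := tendsto_integral_of_dominated_convergence (fun _ ↦ (1 : ℝ)) hmeas
    (integrable_const 1) hbound hlim'
  have hfint : ∫ ω, f ω ∂P = d ^ sleKappaRhoExponent ρ := by
    refine tendsto_nhds_unique hDCT ?_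
    simp_rw [hint]
    exact tendsto_const_nhds
  have hfm : AEStronglyMeasurable f P := aestronglyMeasurable_of_tendsto_ae atTop hmeas hlim'
  set E : Set (ℝ≥0 → ℝ) := {ω | Loewner.hullHitTime (fun s ↦ W s ω) A = ⊤} with hE
  have hEf : E = f ⁻¹' {1} := by
    ext ω
    simp only [hE, hf, mem_setOf_eq, mem_preimage, mem_singleton_iff]
    split_ifs with h <;> simp [h]
  have hEnull : NullMeasurableSet E P := by
    rw [hEf]
    exact hfm.aemeasurable.nullMeasurableSet_preimage (measurableSet_singleton 1)
  obtain ⟨E', -, hE'm, hE'eq⟩ := hEnull.exists_measurable_subset_ae_eq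
  have hfind : f = E.indicator 1 := by
    ext ω
    simp only [hf, hE, indicator, mem_setOf_eq, Pi.one_apply]
  have hfE' : ∫ ω, f ω ∂P = P.real E' := by
    rw [hfind, integral_congr_ae (indicator_ae_eq_of_ae_eq_set hE'eq.symm),
      integral_indicator_one hE'm]
  refine ⟨hEnull, ?_⟩
  rw [← measure_congr hE'eq, ← ofReal_measureReal, ← hfE', hfint]

/-- **On `{T_A = ∞}`, `M_t → 1`** ("Lemma 6.2 shows that a.s. on the event `T = ∞`,
`lim_{r → ∞} h'_{T_r}(W_{T_r}) = 1`. By (8.2), it follows that `lim_{r → ∞} M_{T_r} = 1`"): for a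
sample path with continuous driving function and unbounded `K_∞`, exit times `T(r)` exist at
arbitrarily large times (`Loewner.exists_isExitTime_ge`); there [LSW] Lemma 6.2 (`h62`) makes
`h_t'(W_t) > 1 − ε₁`, so `M_t ≥ h_t'(W_t)^N > (1 − ε₁)^N`; and `M_t` has a limit `≤ 1`.
[cite: LawlerSchrammWerner2003Restriction, end of the proof of Thm. 8.4 (§8.4) with Lemma 6.2] -/
theorem ae_tendsto_one (hM : IsOneSidedMartingale ρ A W M) (h62 : Loewner.restrictionDeriv_exitTime_gt)
    (hA : IsPlusHull A)
    (hcont : ∀ᵐ ω ∂preWienerMeasure, Continuous fun s ↦ W s ω)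
    (hunb : ∀ᵐ ω ∂preWienerMeasure, ¬ Bornology.IsBounded (Loewner.hullUnion fun s ↦ W s ω)) :
    ∀ᵐ ω ∂preWienerMeasure, Loewner.hullHitTime (fun s ↦ W s ω) A = ⊤ →
      Tendsto (fun t ↦ M t ω) atTop (𝓝 1) := by
  obtain ⟨ε, N, hε, hN, hbounds⟩ := hM.ae_rpow_le_le_rpow
  filter_upwards [hbounds, hM.ae_exists_tendsto, hcont, hunb] with ω hbd hlim hWc hKu hT
  obtain ⟨c, hc⟩ := hlim hT
  suffices hc1 : c = 1 by rwa [hc1] at hc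
  have hle : c ≤ 1 := le_of_tendsto' hc fun t ↦ (hM.mem_Icc t ω).2
  refine le_antisymm hle (le_of_forall_pos_lt_add fun ε' hε' ↦ ?_)
  -- `ε₁` with `(1 - ε₁)^N > 1 - ε'/2`, by continuity of `x ↦ x^N` at `1`
  obtain ⟨ε₁, hε₁, hpow⟩ : ∃ ε₁ : ℝ, 0 < ε₁ ∧ ∀ x : ℝ, 1 - ε₁ < x → x ≤ 1 → 1 - ε' / 2 < x ^ N := by
    have hca : ContinuousAt (fun x : ℝ ↦ x ^ N) 1 := Real.continuousAt_rpow_const 1 N (Or.inl one_ne_zero)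
    have hev : ∀ᶠ x in 𝓝 (1 : ℝ), 1 - ε' / 2 < x ^ N := by
      have := hca.eventually (Ioi_mem_nhds (show 1 - ε' / 2 < (1 : ℝ) ^ N by
        rw [Real.one_rpow]; linarith))
      exact this
    obtain ⟨δ, hδ, hδx⟩ := Metric.eventually_nhds_iff.1 hev
    refine ⟨δ, hδ, fun x hx1 hx2 ↦ hδx ?_⟩
    rw [Real.dist_eq, abs_lt]
    exact ⟨by linarith, by linarith⟩
  -- Lemma 6.2 at the exit times, which exist at arbitrarily large times
  have hdisj : ∀ t, Disjoint (Loewner.closedHull (fun s ↦ W s ω) t) A :=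
    Loewner.hullHitTime_eq_top_iff.1 hT
  obtain ⟨r₀, hr₀⟩ := h62 hWc hA hdisj ε₁ hε₁
  have hfreq : ∃ᶠ t : ℝ≥0 in atTop, 1 - ε' / 2 < M t ω := by
    rw [frequently_atTop]
    intro s₀
    obtain ⟨r, t, hr, hst, hexit⟩ := Loewner.exists_isExitTime_ge hWc hKu r₀ s₀
    refine ⟨t, hst, ?_⟩
    obtain ⟨Ψ, e, hΨ, he, he0, he1, hlow, -⟩ := hbd t (by rw [hT]; exact WithTop.coe_lt_top t)
    have h1 : 1 - ε₁ < e := hr₀ r hr t hexit Ψ e hΨ he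
    exact (hpow e h1 he1).trans_le hlow
  have hev : ∀ᶠ t : ℝ≥0 in atTop, M t ω < c + ε' / 2 := hc (Iio_mem_nhds (by linarith))
  obtain ⟨t, ht1, ht2⟩ := (hfreq.and_eventually hev).exists
  linarith

/-- **On `{T_A < ∞}`, `M_t = 0` for `t ≥ T_A`** ("if `T < ∞`, then `K_T ∩ A ⊄ ℝ`, Lemma 6.3
shows that `lim_{t → T−} h_t'(W_t) = 0`, and Lemma 8.10 implies that `lim_{t → T−} M_t = 0`"):
for a sample path with continuous driving function, `W_0 = 0`, and no positive real point ever
swallowed ([LSW] Lemma 8.3 (2): the hypothesis "`K_T ∩ A ∩ ℝ = ∅`" of Lemma 6.3 for `A ∈ 𝒬₊`),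
[LSW] Lemma 6.3 for the smooth hull `A` (`h63`) makes `h_s'(W_s) < ε₁` near `T_A⁻`, so
`M_s ≤ h_s'(W_s)^ε` comes below any `ε'' > 0`, while `M` is frozen at its left limit `≥ 0`.
[cite: LawlerSchrammWerner2003Restriction, end of the proof of Thm. 8.4 (§8.4) with Lemma 6.3 and Lemma 8.10] -/
theorem ae_eq_zero_of_le (hM : IsOneSidedMartingale ρ A W M)
    (h63 : Loewner.RestrictionDerivVanishesAtHit A) (hA : IsPlusHull A)
    (hcont : ∀ᵐ ω ∂preWienerMeasure, Continuous fun s ↦ W s ω) (hW0 : ∀ ω, W 0 ω = 0)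
    (hswallow : ∀ᵐ ω ∂preWienerMeasure, ∀ x : ℝ, 0 < x →
      Loewner.swallowingTime (fun s ↦ W s ω) x = ⊤) :
    ∀ᵐ ω ∂preWienerMeasure, ∀ τ : ℝ≥0, Loewner.hullHitTime (fun s ↦ W s ω) A = τ →
      ∀ t : ℝ≥0, τ ≤ t → M t ω = 0 := by
  obtain ⟨ε, N, hε, hN, hbounds⟩ := hM.ae_rpow_le_le_rpow
  filter_upwards [hbounds, hM.ae_frozen, hcont, hswallow] with ω hbd hfrozen hWc hsw τ hτ t hτt
  have hAc : IsClosed A := hA.1.isBoundedHull.isClosed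
  -- `τ > 0`, so `𝓝[<] τ` is a proper filter
  have hτ0 : 0 < τ := by
    have h := Loewner.hullHitTime_pos hWc (hW0 ω) hAc hA.1.zero_notMem
    rw [hτ] at h
    exact_mod_cast h
  haveI : (𝓝[<] τ).NeBot := nhdsLT_neBot_of_exists_lt ⟨0, hτ0⟩
  have hlimτ : Tendsto (fun s ↦ M s ω) (𝓝[<] τ) (𝓝 (M t ω)) := hfrozen τ hτ t hτt
  have hlt : ∀ᶠ s : ℝ≥0 in 𝓝[<] τ,
      (s : WithTop ℝ≥0) < Loewner.hullHitTime (fun s ↦ W s ω) A := by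
    filter_upwards [self_mem_nhdsWithin] with s hs
    rw [hτ]
    exact_mod_cast hs
  -- Lemma 6.3: `h_s'(W_s) → 0` as `s ↗ τ` (no real point of `A` is swallowed by time `τ`)
  have hnoswallow : ∀ x : ℝ, (x : ℂ) ∈ A →
      ¬ Loewner.swallowingTime (fun s ↦ W s ω) x ≤ (τ : WithTop ℝ≥0) := by
    intro x hxA hle
    rw [hsw x (hA.2 x hxA)] at hle
    exact WithTop.not_top_le_coe τ hle
  have h63' := h63 hWc τ (Loewner.isHullHitTime_of_hullHitTime_eq hτ) hnoswallow
  -- `M_s < ε''` arbitrarily close to `τ`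
  have hfreq : ∀ ε'' : ℝ, 0 < ε'' → ∃ᶠ s : ℝ≥0 in 𝓝[<] τ, M s ω < ε'' := by
    intro ε'' hε''
    have hε₁ : 0 < ε'' ^ (1 / ε) := Real.rpow_pos_of_pos hε'' _
    refine ((h63' _ hε₁).and hlt).frequently.mp (Eventually.of_forall ?_)
    rintro s ⟨hs, hsT⟩
    obtain ⟨Ψ, e, hΨ, he, he0, -, -, hup⟩ := hbd s hsT
    have hes : e < ε'' ^ (1 / ε) := hs Ψ e hΨ he
    calc M s ω ≤ e ^ ε := hup
      _ < (ε'' ^ (1 / ε)) ^ ε := Real.rpow_lt_rpow he0.le hes hε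
      _ = ε'' := by
          rw [← Real.rpow_mul hε''.le, one_div, inv_mul_cancel₀ hε.ne', Real.rpow_one]
  have hle : ∀ ε'' : ℝ, 0 < ε'' → M t ω ≤ ε'' := fun ε'' hε'' ↦ by
    by_contra hgt
    push Not at hgt
    obtain ⟨s, hs1, hs2⟩ := ((hfreq ε'' hε'').and_eventually (hlimτ (Ioi_mem_nhds hgt))).exists
    exact lt_irrefl _ (hs1.trans hs2)
  refine le_antisymm (le_of_forall_pos_lt_add fun ε'' hε'' ↦ ?_) (hM.mem_Icc t ω).1
  linarith [hle (ε'' / 2) (half_pos hε'')]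

/-- **`M_t → 1_{T_A = ∞}` almost surely**, for the martingale of a smooth `+`-hull along an
SLE(8/3, ρ) driving process with continuous paths, unbounded `K_∞` and no positive real point
swallowed. [cite: LawlerSchrammWerner2003Restriction, end of the proof of Thm. 8.4 (§8.4)] -/
theorem ae_tendsto_indicator (hM : IsOneSidedMartingale ρ A W M)
    (h62 : Loewner.restrictionDeriv_exitTime_gt) (h63 : Loewner.RestrictionDerivVanishesAtHit A)
    (hA : IsPlusHull A) (hcont : ∀ᵐ ω ∂preWienerMeasure, Continuous fun s ↦ W s ω)
    (hW0 : ∀ ω, W 0 ω = 0)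
    (hunb : ∀ᵐ ω ∂preWienerMeasure, ¬ Bornology.IsBounded (Loewner.hullUnion fun s ↦ W s ω))
    (hswallow : ∀ᵐ ω ∂preWienerMeasure, ∀ x : ℝ, 0 < x →
      Loewner.swallowingTime (fun s ↦ W s ω) x = ⊤) :
    ∀ᵐ ω ∂preWienerMeasure, Tendsto (fun t ↦ M t ω) atTop
      (𝓝 (if Loewner.hullHitTime (fun s ↦ W s ω) A = ⊤ then 1 else 0)) := by
  filter_upwards [hM.ae_tendsto_one h62 hA hcont hunb,
    hM.ae_eq_zero_of_le h63 hA hcont hW0 hswallow] with ω h1 h0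
  split_ifs with hT
  · exact h1 hT
  · obtain ⟨τ, hτ⟩ := WithTop.ne_top_iff_exists.1 hT
    refine tendsto_const_nhds.congr' ?_
    filter_upwards [eventually_ge_atTop τ] with t ht
    exact (h0 τ hτ.symm t ht).symm

end SLEKappaRho.IsOneSidedMartingale


/-! ### `P[T_A = ∞] = Φ_A'(0)^α` for smooth `A ∈ 𝒬₊`, from the leaves -/

section SmoothCase

variable {ρ : ℝ} {O W : ℝ≥0 → (ℝ≥0 → ℝ) → ℝ} {A : Set ℂ}

/-- Lemma 8.3 (2) at `κ = 8/3`: a.s. no positive real point is ever swallowed by the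
SLE(8/3, ρ) chain. [cite: LawlerSchrammWerner2003Restriction, Lemma 8.3 (2)–(3) (p. 36)] -/
theorem SLEKappaRho.ae_swallowingTime_ofReal_eq_top (h83 : SLEKappaRho.swallowingTime_ofReal)
    (hρ : -2 < ρ) (hOW : IsSLEKappaRhoPair (8 / 3) ρ O W) :
    ∀ᵐ ω ∂preWienerMeasure, ∀ x : ℝ, 0 < x → Loewner.swallowingTime (fun s ↦ W s ω) x = ⊤ := by
  have hκ0 : (0 : ℝ≥0) < 8 / 3 := by positivity
  have hκ4 : (8 : ℝ≥0) / 3 ≤ 4 := by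
    rw [div_le_iff₀ (by norm_num : (0 : ℝ≥0) < 3)]
    norm_num
  filter_upwards [h83 hκ0 hκ4 hρ hOW] with ω hω x hx
  exact (hω x).1 hx

/-- **`P[T_A = ∞] = Φ_A'(0)^α` for a smooth hull `A ∈ 𝒬₊`** — the end of the proof of [LSW]
Thm. 8.4 assembled from its printed inputs: the martingale `M` (Lemmas 8.9/8.10, `hM`), Lemma 6.2
(`h62`), Lemma 6.3 (`h63`), Lemma 8.3 (2) and (4) (`h83`, `h84`) and the continuity of the
driving process (`hint`); the event `{T_A = ∞}` is null-measurable.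
[cite: LawlerSchrammWerner2003Restriction, end of the proof of Thm. 8.4 (§8.4)] -/
theorem SLEKappaRho.measure_hullHitTime_eq_top [Fact Process.isProjectiveLimit_preWienerMeasure]
    (hint : SLEKappaRho.integral_inv_eq) (hM : SLEKappaRho.exists_isOneSidedMartingale)
    (h62 : Loewner.restrictionDeriv_exitTime_gt) (h63 : IsSmoothHull.restrictionDerivVanishesAtHit)
    (h83 : SLEKappaRho.swallowingTime_ofReal) (h84 : SLEKappaRho.not_isBounded_hullUnion)
    (hρ : -2 < ρ) (hOW : IsSLEKappaRhoPair (8 / 3) ρ O W) (hAs : IsSmoothHull A) (hA : IsPlusHull A)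
    {Φ : ConformalEquiv (upperHalfPlaneSet \ A) upperHalfPlaneSet} (hΦ : IsRestrictionMap A Φ)
    {d : ℝ} (hd : HasRestrictionDeriv A Φ d) :
    NullMeasurableSet {ω | Loewner.hullHitTime (fun s ↦ W s ω) A = ⊤} preWienerMeasure ∧
      preWienerMeasure {ω | Loewner.hullHitTime (fun s ↦ W s ω) A = ⊤} =
        ENNReal.ofReal (d ^ sleKappaRhoExponent ρ) := by
  obtain ⟨M, hMω⟩ := hM hρ hOW hAs hA
  have hκ0 : (0 : ℝ≥0) < 8 / 3 := by positivity
  have hcont : ∀ᵐ ω ∂preWienerMeasure, Continuous fun s ↦ W s ω :=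
    (hOW.ae_continuous hint hκ0 hρ).mono fun ω hω ↦ hω.1
  exact hMω.measure_hullHitTime_eq_top_of_tendsto hΦ hd
    (hMω.ae_tendsto_indicator h62 (h63 hAs hA.1) hA hcont hOW.snd_zero (h84 hκ0 hρ hOW)
      (SLEKappaRho.ae_swallowingTime_ofReal_eq_top h83 hρ hOW))

end SmoothCase

/-! ### From `{T_A = ∞}` to `{K ∩ A = ∅}`: the closure of `K_∞` (last paragraph of the proof of Thm. 8.4)

The last paragraph of the proof of [LSW] Thm. 8.4 (§8.4), verbatim: "It remains to prove that
a.s. `K̄_∞ ∩ A = ∅` iff `K_∞ ∩ A = ∅`. As `K_t` is closed for each `t`, the proof of this fact is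
essentially identical to the argument showing that `⋂_{s>0} Ξ̄_s = ∅` given at the end of the
proof of Theorem 7.3." Here `K_∞ = ⋃_{t ≥ 0} K_t` for the hulls `K_t ⊆ ℍ̄` of SLE(8/3, ρ) in the
closed half-plane (`Loewner.closedHull` of the driving function `t ↦ W_t(ω)`), and `A` is the
smooth hull of `𝒬₊` fixed in §8.4. This step of the proof is carried below as the explicit
closure hypothesis `hcl` of `SLEKappaRho.measure_fill_disjoint_of_isSmoothHull` (one hull) and of
`SLEKappaRho.measure_fill_disjoint_of_leaves` (all smooth hulls of `𝒬₊`), and it is PROVED from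
the other leaves of Thm. 8.4 in `SLEKappaRhoRestrictionProofs`
(`SLEKappaRho.ae_disjoint_closure_iff_of_leaves`: on `{T_A = ∞}` a point of `cl K_∞ ∩ A` forces
`T_{E_δ} < ∞` for the outer smooth hulls `E_δ ⊇ A` of Lemma 2.1, an event of probability
`Φ_A'(0)^α − Φ'_{E_δ}(0)^α → 0`). What this section proves is the identification of the events
it affords. -/

section Closure

variable {U : ℝ≥0 → ℝ} {A : Set ℂ}

/-- If no positive real point is swallowed, the closed hulls add to the open hulls only points
of `(−∞, 0]`: `⋃ K_t ⊆ ⋃ K_tᵒ ∪ {Im = 0, Re ≤ 0}`. [folklore] -/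
theorem Loewner.iUnion_closedHull_subset (hsw : ∀ x : ℝ, 0 < x → Loewner.swallowingTime U x = ⊤) :
    (⋃ t, Loewner.closedHull U t) ⊆ Loewner.hullUnion U ∪ {z : ℂ | z.im = 0 ∧ z.re ≤ 0} := by
  rintro z hz
  obtain ⟨t, ht⟩ := mem_iUnion.1 hz
  rcases Loewner.mem_closedHull_iff.1 ht with h | ⟨him, hT⟩
  · exact Or.inl (mem_iUnion.2 ⟨t, h⟩)
  · refine Or.inr ⟨him, ?_⟩
    by_contra hre
    push Not at hre
    have hzx : z = ((z.re : ℝ) : ℂ) := Complex.ext (by simp) (by simp [him])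
    rw [hzx, hsw z.re hre] at hT
    exact WithTop.not_top_le_coe t hT

/-- **`{K ∩ A = ∅} = {T_A = ∞}` for a sample path** with no positive real point swallowed and
for which "`K̄_∞ ∩ A = ∅` iff `K_∞ ∩ A = ∅`" holds, `A ∈ 𝒬₊`: the filling is irrelevant
(`IsPlusHull.disjoint_leftFilling_iff`), the closures of `⋃ K_tᵒ` and of `⋃ K_t` meet `A`
simultaneously (they differ inside `(−∞, 0]`, off `A`), and `⋃ K_t ∩ A = ∅` says `T_A = ∞`.
[cite: LawlerSchrammWerner2003Restriction, proof of Thm. 8.4, last paragraph (§8.4)] -/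
theorem IsPlusHull.disjoint_sleKappaRhoFill_iff (hA : IsPlusHull A) {W : ℝ≥0 → (ℝ≥0 → ℝ) → ℝ}
    {ω : ℝ≥0 → ℝ} (hsw : ∀ x : ℝ, 0 < x → Loewner.swallowingTime (fun s ↦ W s ω) x = ⊤)
    (hcl : Disjoint (closure (⋃ t, Loewner.closedHull (fun s ↦ W s ω) t)) A ↔
      Disjoint (⋃ t, Loewner.closedHull (fun s ↦ W s ω) t) A) :
    Disjoint (sleKappaRhoFill W ω) A ↔ Loewner.hullHitTime (fun s ↦ W s ω) A = ⊤ := by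
  rw [sleKappaRhoFill, hA.disjoint_leftFilling_iff, Loewner.hullHitTime_eq_top_iff,
    ← Set.disjoint_iUnion_left, ← hcl]
  set Uc := ⋃ t, Loewner.closedHull (fun s ↦ W s ω) t
  have hsub : closure Uc ⊆ closure (Loewner.hullUnion fun s ↦ W s ω) ∪ {z : ℂ | z.im = 0 ∧ z.re ≤ 0} := by
    have hL : IsClosed {z : ℂ | z.im = 0 ∧ z.re ≤ 0} :=
      (isClosed_eq Complex.continuous_im continuous_const).inter
        (isClosed_le Complex.continuous_re continuous_const)
    calc closure Uc ⊆ closure (Loewner.hullUnion (fun s ↦ W s ω) ∪ {z : ℂ | z.im = 0 ∧ z.re ≤ 0}) :=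
          closure_mono (Loewner.iUnion_closedHull_subset hsw)
      _ = closure (Loewner.hullUnion fun s ↦ W s ω) ∪ {z : ℂ | z.im = 0 ∧ z.re ≤ 0} := by
          rw [closure_union, hL.closure_eq]
  have hLA : ∀ z ∈ A, ¬ (z.im = 0 ∧ z.re ≤ 0) := by
    rintro z hzA ⟨him, hre⟩
    have hzx : z = ((z.re : ℝ) : ℂ) := Complex.ext (by simp) (by simp [him])
    rw [hzx] at hzA
    linarith [hA.2 z.re hzA]
  constructor
  · intro h
    refine Set.disjoint_left.2 fun z hz hzA ↦ ?_
    rcases hsub hz with h1 | h2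
    · exact Set.disjoint_left.1 h h1 hzA
    · exact hLA z hzA h2
  · intro h
    exact h.mono_left (closure_mono (iUnion_mono fun t ↦ Loewner.hull_subset_closedHull _ t))

end Closure

section Assembly

variable {ρ : ℝ} {O W : ℝ≥0 → (ℝ≥0 → ℝ) → ℝ} {A : Set ℂ}

/-- **Thm. 8.4 (avoidance form) for a SMOOTH hull `A ∈ 𝒬₊`, given the closure statement**:
`P[F^{ℝ₊}_ℍ(cl K_∞) ∩ A = ∅] = Φ_A'(0)^α` (and the event is null-measurable), from
`P[T_A = ∞] = Φ_A'(0)^α` (`SLEKappaRho.measure_hullHitTime_eq_top`) and the a.s. identity of the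
two events (`IsPlusHull.disjoint_sleKappaRhoFill_iff`, with Lemma 8.3 (2) and the closure
hypothesis `hcl`: a.s. "`K̄_∞ ∩ A = ∅` iff `K_∞ ∩ A = ∅`" along this driving process — the last
paragraph of the proof of Thm. 8.4, proved from the other leaves in `SLEKappaRhoRestrictionProofs`,
`SLEKappaRho.ae_disjoint_closure_iff_of_leaves`).
[cite: LawlerSchrammWerner2003Restriction, Thm. 8.4 (p. 37) and its proof (§8.4), smooth hulls] -/
theorem SLEKappaRho.measure_fill_disjoint_of_isSmoothHull [Fact Process.isProjectiveLimit_preWienerMeasure]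
    (hint : SLEKappaRho.integral_inv_eq) (hM : SLEKappaRho.exists_isOneSidedMartingale)
    (h62 : Loewner.restrictionDeriv_exitTime_gt) (h63 : IsSmoothHull.restrictionDerivVanishesAtHit)
    (h83 : SLEKappaRho.swallowingTime_ofReal) (h84 : SLEKappaRho.not_isBounded_hullUnion)
    (hρ : -2 < ρ) (hOW : IsSLEKappaRhoPair (8 / 3) ρ O W) (hAs : IsSmoothHull A) (hA : IsPlusHull A)
    (hcl : ∀ᵐ ω ∂preWienerMeasure,
      Disjoint (closure (⋃ t, Loewner.closedHull (fun s ↦ W s ω) t)) A ↔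
        Disjoint (⋃ t, Loewner.closedHull (fun s ↦ W s ω) t) A)
    {Φ : ConformalEquiv (upperHalfPlaneSet \ A) upperHalfPlaneSet} (hΦ : IsRestrictionMap A Φ)
    {d : ℝ} (hd : HasRestrictionDeriv A Φ d) :
    NullMeasurableSet {ω | Disjoint (sleKappaRhoFill W ω) A} preWienerMeasure ∧
      preWienerMeasure {ω | Disjoint (sleKappaRhoFill W ω) A} =
        ENNReal.ofReal (d ^ sleKappaRhoExponent ρ) := by
  obtain ⟨hnull, hP⟩ :=
    SLEKappaRho.measure_hullHitTime_eq_top hint hM h62 h63 h83 h84 hρ hOW hAs hA hΦ hd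
  have hae : {ω | Disjoint (sleKappaRhoFill W ω) A} =ᵐ[preWienerMeasure]
      {ω | Loewner.hullHitTime (fun s ↦ W s ω) A = ⊤} := by
    refine Filter.eventuallyEq_set.2 ?_
    filter_upwards [SLEKappaRho.ae_swallowingTime_ofReal_eq_top h83 hρ hOW, hcl] with ω hsw hclω
    exact hA.disjoint_sleKappaRhoFill_iff hsw hclω
  exact ⟨hnull.congr hae.symm, by rw [measure_congr hae, hP]⟩

/-- **The hulls do not accumulate on the positive axis: a.s. `cl K_∞ ∩ [a, b] = ∅`** for
`0 < a < b` — the half-ellipse argument ([LSW] end of the proof of Thm. 7.3, §7.2 p. 29: "Let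
`D := {z ∈ ℍ̄ : |z − x₀| ≤ ε}` […]. Then `1 − Φ_D'(0) = O(ε²)`. Consequently,
`P[dist(Ξ, [1,2]) < ε] = O(ε)`. Thus, a.s., `Ξ̄ ∩ [1,2] = ∅`", the argument the last paragraph of
the proof of Thm. 8.4 refers to), run with the tree's half-ellipse hulls: for `η > 0` the hull
`B = ellHull a b ρ₀` (`EllipseHulls`), `ρ₀` close to `1`, is a `+`-hull neighbourhood of
`[a, b]` in `ℍ̄` with `Φ_B'(0) > 1 − η/2` (`ellDeriv → 1`), and a smooth hull `J ⊇ B` of `𝒬₊`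
from [LSW] Lemma 2.1 (`IsPlusHull.exists_antitone_isSmoothHull_holds`) has `Φ_J'(0) > 1 − η`; a
point of `[a, b]` in `cl K_∞` puts a point of some `K_t` inside `J`, so
`P[cl K_∞ ∩ [a, b] ≠ ∅] ≤ P[T_J < ∞] = 1 − Φ_J'(0)^α ≤ 1 − (1 − η)^α → 0`.
[cite: LawlerSchrammWerner2003Restriction, end of the proof of Thm. 7.3 (§7.2 p. 29) and proof of Thm. 8.4, last paragraph (§8.4)] -/
theorem SLEKappaRho.measure_closure_hullUnion_inter_realSeg [Fact Process.isProjectiveLimit_preWienerMeasure]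
    (hint : SLEKappaRho.integral_inv_eq) (hM : SLEKappaRho.exists_isOneSidedMartingale)
    (h62 : Loewner.restrictionDeriv_exitTime_gt) (h63 : IsSmoothHull.restrictionDerivVanishesAtHit)
    (h83 : SLEKappaRho.swallowingTime_ofReal) (h84 : SLEKappaRho.not_isBounded_hullUnion)
    (hρ : -2 < ρ) (hOW : IsSLEKappaRhoPair (8 / 3) ρ O W) {a b : ℝ} (ha : 0 < a) (hab : a < b) :
    preWienerMeasure {ω | ¬ Disjoint (closure (Loewner.hullUnion fun s ↦ W s ω)) (realSeg a b)} = 0 := by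
  set S : Set (ℝ≥0 → ℝ) :=
    {ω | ¬ Disjoint (closure (Loewner.hullUnion fun s ↦ W s ω)) (realSeg a b)} with hS
  have hα : 0 < sleKappaRhoExponent ρ := sleKappaRhoExponent_pos hρ
  -- Step 1: for every `η ∈ (0, 1)`, `P S ≤ 1 - (1 - η)^α`
  have hstep : ∀ η : ℝ, 0 < η → η < 1 →
      preWienerMeasure S ≤ 1 - ENNReal.ofReal ((1 - η) ^ sleKappaRhoExponent ρ) := by
    intro η hη hη1
    -- a half-ellipse hull around `[a, b]` with derivative `> 1 - η/2`
    obtain ⟨ρ₀, hρ₀0, hρ₀1, hB, hder⟩ : ∃ ρ₀ : ℝ, 0 < ρ₀ ∧ ρ₀ < 1 ∧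
        ellH a b * jLevel ρ₀ < ellC a b ∧ 1 - η / 2 < ellDeriv a b ρ₀ := by
      have h1 : ∀ᶠ r in 𝓝[<] (1 : ℝ), 0 < r := by
        have : Ioo (0 : ℝ) 1 ∈ 𝓝[<] (1 : ℝ) := Ioo_mem_nhdsLT one_pos
        filter_upwards [this] with r hr using hr.1
      have h2 : ∀ᶠ r in 𝓝[<] (1 : ℝ), r < 1 := eventually_nhdsWithin_of_forall fun r hr ↦ hr
      have h3 : ∀ᶠ r in 𝓝[<] (1 : ℝ), ellH a b * jLevel r < ellC a b := by
        have hlim : Tendsto (fun r ↦ ellH a b * jLevel r) (𝓝[<] (1 : ℝ)) (𝓝 (ellH a b * 2)) :=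
          (tendsto_jLevel_one.mono_left nhdsWithin_le_nhds).const_mul _
        have hlt : ellH a b * 2 < ellC a b := by rw [ellH, ellC]; linarith
        exact hlim (Iio_mem_nhds hlt)
      have h4 : ∀ᶠ r in 𝓝[<] (1 : ℝ), 1 - η / 2 < ellDeriv a b r := by
        have hlim : Tendsto (ellDeriv a b) (𝓝[<] (1 : ℝ)) (𝓝 1) := by
          have := (tendsto_ellDeriv a b).mono_left (nhdsWithin_le_nhds (s := Iio (1 : ℝ)))
          rwa [ellDeriv_one hab ha] at this
        exact hlim (Ioi_mem_nhds (by linarith))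
      obtain ⟨r, hr1, hr2, hr3, hr4⟩ := (h1.and (h2.and (h3.and h4))).exists
      exact ⟨r, hr1, hr2, hr3, hr4⟩
    set B : Set ℂ := ellHull a b ρ₀ with hBdef
    have hBp : IsPlusHull B := isPlusHull_ellHull hab hρ₀0 hρ₀1 hB
    have hBne : B.Nonempty := ⟨a, realSeg_subset_ellRegion hab hρ₀0 hρ₀1
      (ofReal_mem_realSeg.2 left_mem_uIcc), by simp⟩
    -- Lemma 2.1: smooth `+`-hulls `J n ↓ F ⊇ B` with `Φ'_{J n}(0) → Φ_B'(0)`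
    obtain ⟨J, F, hJs, hJp, hJm, hJi, hBF, -, -, hconv⟩ :=
      IsPlusHull.exists_antitone_isSmoothHull_holds hBp hBne
    have hdata : ∀ n, ∃ (Ψ : ConformalEquiv (upperHalfPlaneSet \ J n) upperHalfPlaneSet) (e : ℝ),
        IsRestrictionMap (J n) Ψ ∧ HasRestrictionDeriv (J n) Ψ e := fun n ↦ by
      obtain ⟨Ψ, hΨ, -⟩ := IsStarHull.existsUnique_isRestrictionMap_holds (hJp n).1
      obtain ⟨e, -, -, he⟩ := IsStarHull.exists_hasRestrictionDeriv_holds (hJp n).1 hΨ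
      exact ⟨Ψ, e, hΨ, he⟩
    choose Ψ dn hΨ hdn using hdata
    obtain ⟨-, hlim⟩ := hconv (isRestrictionMap_ellConf hab hρ₀0 hρ₀1 hB)
      (hasRestrictionDeriv_ellConf hab hρ₀0 hρ₀1 hB) hΨ hdn
    obtain ⟨n, hn⟩ := (hlim.eventually (Ioi_mem_nhds hder)).exists
    have hdn1 : 1 - η < dn n := by linarith [hn.le, show 1 - η / 2 ≤ dn n from hn.le]
    -- `S ⊆ {T_{J n} ≠ ⊤}`
    have hδ : 0 < ellH a b * (jLevel ρ₀ - 2) :=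
      mul_pos (ellH_pos hab) (by linarith [two_lt_jLevel hρ₀0 hρ₀1])
    have hSsub : S ⊆ {ω | Loewner.hullHitTime (fun s ↦ W s ω) (J n) = ⊤}ᶜ := by
      intro ω hω hT
      simp only [hS, mem_setOf_eq, Set.not_disjoint_iff] at hω
      obtain ⟨z, hzcl, hzseg⟩ := hω
      obtain ⟨w, hw, hwz⟩ := Metric.mem_closure_iff.1 hzcl _ hδ
      obtain ⟨t, hwt⟩ := mem_iUnion.1 hw
      have hwB : w ∈ B := by
        refine ⟨mem_ellRegion_of_infDist_lt hab le_rfl ?_,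
          show 0 ≤ w.im from le_of_lt (Loewner.hull_subset _ t hwt)⟩
        rw [dist_comm] at hwz
        exact (infDist_le_dist_of_mem hzseg).trans_lt hwz
      have hwJ : w ∈ J n := (hBF.trans (hJi ▸ iInter_subset J n)) hwB
      have hdisj := Loewner.hullHitTime_eq_top_iff.1 (by exact hT) t
      exact Set.disjoint_left.1 hdisj (Loewner.hull_subset_closedHull _ t hwt) hwJ
    -- the measure bound
    obtain ⟨hnull, hPJ⟩ := SLEKappaRho.measure_hullHitTime_eq_top hint hM h62 h63 h83 h84 hρ hOW
      (hJs n) (hJp n) (hΨ n) (hdn n)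
    calc preWienerMeasure S ≤ preWienerMeasure {ω | Loewner.hullHitTime (fun s ↦ W s ω) (J n) = ⊤}ᶜ :=
          measure_mono hSsub
      _ = 1 - ENNReal.ofReal (dn n ^ sleKappaRhoExponent ρ) := by
          rw [prob_compl_eq_one_sub₀ hnull, hPJ]
      _ ≤ 1 - ENNReal.ofReal ((1 - η) ^ sleKappaRhoExponent ρ) := by
          gcongr 1 - ENNReal.ofReal ?_
          exact Real.rpow_le_rpow (by linarith) hdn1.le hα.le
  -- Step 2: `1 - (1 - η)^α → 0` as `η → 0`
  have htend : Tendsto (fun k : ℕ ↦ 1 - ENNReal.ofReal ((1 - 1 / ((k : ℝ) + 2)) ^ sleKappaRhoExponent ρ))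
      atTop (𝓝 0) := by
    have h1 : Tendsto (fun k : ℕ ↦ 1 - 1 / ((k : ℝ) + 2)) atTop (𝓝 1) := by
      have : Tendsto (fun k : ℕ ↦ 1 / ((k : ℝ) + 2)) atTop (𝓝 0) :=
        tendsto_const_nhds.div_atTop
          (tendsto_atTop_add_const_right _ _ tendsto_natCast_atTop_atTop)
      simpa using tendsto_const_nhds.sub this
    have h2 : Tendsto (fun k : ℕ ↦ (1 - 1 / ((k : ℝ) + 2)) ^ sleKappaRhoExponent ρ) atTop (𝓝 1) := by
      have := h1.rpow_const (p := sleKappaRhoExponent ρ) (Or.inr hα.le)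
      rwa [Real.one_rpow] at this
    have h3 : Tendsto (fun k : ℕ ↦ ENNReal.ofReal ((1 - 1 / ((k : ℝ) + 2)) ^ sleKappaRhoExponent ρ))
        atTop (𝓝 1) := by
      rw [← ENNReal.ofReal_one]
      exact ENNReal.tendsto_ofReal h2
    have h4 := ((ENNReal.continuous_sub_left ENNReal.one_ne_top).tendsto 1).comp h3
    rw [tsub_self] at h4
    exact h4
  refine le_antisymm (ge_of_tendsto' htend fun k ↦ hstep _ (by positivity) ?_) bot_le
  rw [div_lt_one (by positivity)]
  have hk : (0 : ℝ) ≤ k := Nat.cast_nonneg k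
  linarith

/-- **A.s. `cl K_∞ ∩ (0, ∞) = ∅`** for SLE(8/3, ρ) (the closure of the union of the open hulls
contains no positive real point): from `SLEKappaRho.measure_closure_hullUnion_inter_realSeg`
over the rational intervals. [cite: LawlerSchrammWerner2003Restriction, Lemma 8.3 (2)–(3) and Thm. 8.4 (K ∈ Ω₊: K ∩ ℝ = (−∞, 0])] -/
theorem SLEKappaRho.ae_ofReal_notMem_closure_hullUnion [Fact Process.isProjectiveLimit_preWienerMeasure]
    (hint : SLEKappaRho.integral_inv_eq) (hM : SLEKappaRho.exists_isOneSidedMartingale)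
    (h62 : Loewner.restrictionDeriv_exitTime_gt) (h63 : IsSmoothHull.restrictionDerivVanishesAtHit)
    (h83 : SLEKappaRho.swallowingTime_ofReal) (h84 : SLEKappaRho.not_isBounded_hullUnion)
    (hρ : -2 < ρ) (hOW : IsSLEKappaRhoPair (8 / 3) ρ O W) :
    ∀ᵐ ω ∂preWienerMeasure, ∀ x : ℝ, 0 < x →
      (x : ℂ) ∉ closure (Loewner.hullUnion fun s ↦ W s ω) := by
  have hq : ∀ q : ℚ × ℚ, ∀ᵐ ω ∂preWienerMeasure, (0 : ℝ) < q.1 → (q.1 : ℝ) < q.2 →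
      Disjoint (closure (Loewner.hullUnion fun s ↦ W s ω)) (realSeg q.1 q.2) := by
    intro q
    by_cases h : (0 : ℝ) < q.1 ∧ (q.1 : ℝ) < q.2
    · have h0 := SLEKappaRho.measure_closure_hullUnion_inter_realSeg hint hM h62 h63 h83 h84 hρ hOW
        h.1 h.2
      filter_upwards [measure_eq_zero_iff_ae_notMem.1 h0] with ω hω _ _ using not_not.1 hω
    · exact Eventually.of_forall fun ω h1 h2 ↦ absurd ⟨h1, h2⟩ h
  rw [← ae_all_iff] at hq
  filter_upwards [hq] with ω hω x hx hxcl
  obtain ⟨q₁, hq₁0, hq₁x⟩ := exists_rat_btwn hx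
  obtain ⟨q₂, hxq₂, -⟩ := exists_rat_btwn (lt_add_one x)
  have hdisj := hω (q₁, q₂) (by exact_mod_cast hq₁0) (hq₁x.trans hxq₂)
  refine Set.disjoint_left.1 hdisj hxcl (ofReal_mem_realSeg.2 ?_)
  rw [uIcc_of_le (hq₁x.trans hxq₂).le]
  exact ⟨hq₁x.le, hxq₂.le⟩

/-- **Thm. 8.4 (avoidance form) for every `A ∈ 𝒬₊`, by [LSW] Lemma 2.1**: with smooth `+`-hulls
`J n ↓ F ⊇ A` (`F ∖ A ⊆ (0, ∞)`, `Φ'_{J n}(0) → Φ_A'(0)`), the events `{K ∩ J n = ∅}` increase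
and their union is `{K ∩ A = ∅}` up to a null set — `K` is closed, a.s. contains no positive
real point (`SLEKappaRho.ae_ofReal_notMem_closure_hullUnion`), so `K ∩ F = ∅` as soon as
`K ∩ A = ∅`, and then the compact `K ∩ J 0` misses some `J n` — while their probabilities
`Φ'_{J n}(0)^α` converge to `Φ_A'(0)^α`. (The reduction to smooth hulls is implicit in [LSW]
§8.4, "Let `A ∈ 𝒬₊` be a given smooth hull", as in the proof of Thm. 6.1: "By Proposition 3.3,
it suffices to consider the case where `A` is a smooth hull".) The hypotheses are six named
facts — the integrated Bessel equation of §8.3 (`hint`), Lemmas 8.9/8.10 (`hM`), Lemma 6.2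
(`h62`), Lemma 6.3 (`h63`), Lemma 8.3 (2)–(3) (`h83`) and Lemma 8.3 (4) (`h84`) — and the closure
hypothesis `hcl` (the last paragraph of the proof of Thm. 8.4: for every SLE(8/3, ρ) driving pair
and every smooth `A ∈ 𝒬₊`, a.s. `cl K_∞ ∩ A = ∅ ↔ K_∞ ∩ A = ∅`), which
`SLEKappaRhoRestrictionProofs` proves from the others (`SLEKappaRho.ae_disjoint_closure_iff_of_leaves`),
so that Thm. 8.4 rests on five named facts (`SLEKappaRho.measure_fill_disjoint_of_five_leaves`).
[cite: LawlerSchrammWerner2003Restriction, Thm. 8.4 (p. 37) with Lemma 2.1 (p. 8)] -/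
theorem SLEKappaRho.measure_fill_disjoint_of_leaves
    (hint : SLEKappaRho.integral_inv_eq) (hM : SLEKappaRho.exists_isOneSidedMartingale)
    (hcl : ∀ {ρ : ℝ} {O W : ℝ≥0 → (ℝ≥0 → ℝ) → ℝ}, -2 < ρ → IsSLEKappaRhoPair (8 / 3) ρ O W →
      ∀ {A : Set ℂ}, IsSmoothHull A → IsPlusHull A →
        ∀ᵐ ω ∂preWienerMeasure,
          Disjoint (closure (⋃ t, Loewner.closedHull (fun s ↦ W s ω) t)) A ↔
            Disjoint (⋃ t, Loewner.closedHull (fun s ↦ W s ω) t) A)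
    (h62 : Loewner.restrictionDeriv_exitTime_gt) (h63 : IsSmoothHull.restrictionDerivVanishesAtHit)
    (h83 : SLEKappaRho.swallowingTime_ofReal) (h84 : SLEKappaRho.not_isBounded_hullUnion) :
    SLEKappaRho.measure_fill_disjoint := by
  haveI : Fact Process.isProjectiveLimit_preWienerMeasure := ⟨isProjectiveLimit_preWienerMeasure_holds⟩
  intro ρ O W hρ hOW A hA Φ hΦ d hd
  rcases A.eq_empty_or_nonempty with rfl | hne
  · -- the empty hull: probability one, `Φ_∅'(0) = 1`
    have hd1 : d = 1 :=
      HasRestrictionDeriv.eq_of_isRestrictionMap IsStarHull.existsUnique_isRestrictionMap_holds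
        isStarHull_empty isRestrictionMap_empty hΦ hasRestrictionDeriv_empty hd
    subst hd1
    simp [Real.one_rpow]
  -- Lemma 2.1
  obtain ⟨J, F, hJs, hJp, hJm, hJi, hAF, hFA, h0F, hconv⟩ :=
    IsPlusHull.exists_antitone_isSmoothHull_holds hA hne
  have hdata : ∀ n, ∃ (Ψ : ConformalEquiv (upperHalfPlaneSet \ J n) upperHalfPlaneSet) (e : ℝ),
      IsRestrictionMap (J n) Ψ ∧ HasRestrictionDeriv (J n) Ψ e := fun n ↦ by
    obtain ⟨Ψ, hΨ, -⟩ := IsStarHull.existsUnique_isRestrictionMap_holds (hJp n).1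
    obtain ⟨e, -, -, he⟩ := IsStarHull.exists_hasRestrictionDeriv_holds (hJp n).1 hΨ
    exact ⟨Ψ, e, hΨ, he⟩
  choose Ψ dn hΨ hdn using hdata
  obtain ⟨-, hlim⟩ := hconv hΦ hd hΨ hdn
  -- the increasing events `{K ∩ J n = ∅}`
  set E : ℕ → Set (ℝ≥0 → ℝ) := fun n ↦ {ω | Disjoint (sleKappaRhoFill W ω) (J n)} with hE
  have hEn : ∀ n, preWienerMeasure (E n) = ENNReal.ofReal (dn n ^ sleKappaRhoExponent ρ) := fun n ↦
    (SLEKappaRho.measure_fill_disjoint_of_isSmoothHull hint hM h62 h63 h83 h84 hρ hOW (hJs n)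
      (hJp n) (hcl hρ hOW (hJs n) (hJp n)) (hΨ n) (hdn n)).2
  have hmono : Monotone E := fun m n hmn ω hω ↦ Disjoint.mono_right (hJm hmn) hω
  have h1 : Tendsto (preWienerMeasure ∘ E) atTop (𝓝 (preWienerMeasure (⋃ n, E n))) :=
    tendsto_measure_iUnion_atTop hmono
  have h2 : Tendsto (preWienerMeasure ∘ E) atTop
      (𝓝 (ENNReal.ofReal (d ^ sleKappaRhoExponent ρ))) := by
    have : preWienerMeasure ∘ E = fun n ↦ ENNReal.ofReal (dn n ^ sleKappaRhoExponent ρ) := funext hEn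
    rw [this]
    exact ENNReal.tendsto_ofReal (hlim.rpow_const (Or.inr (sleKappaRhoExponent_pos hρ).le))
  have hU : preWienerMeasure (⋃ n, E n) = ENNReal.ofReal (d ^ sleKappaRhoExponent ρ) :=
    tendsto_nhds_unique h1 h2
  -- `{K ∩ A = ∅} = ⋃ₙ {K ∩ J n = ∅}` almost surely
  have hae : {ω | Disjoint (sleKappaRhoFill W ω) A} =ᵐ[preWienerMeasure] ⋃ n, E n := by
    refine Filter.eventuallyEq_set.2 ?_
    filter_upwards [SLEKappaRho.ae_ofReal_notMem_closure_hullUnion hint hM h62 h63 h83 h84 hρ hOW]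
      with ω hreal
    simp only [mem_setOf_eq, mem_iUnion, hE]
    constructor
    · intro hω
      -- `K ∩ F = ∅`
      have hKF : Disjoint (sleKappaRhoFill W ω) F := by
        refine Set.disjoint_left.2 fun z hzK hzF ↦ ?_
        have hzim : 0 ≤ z.im := sleKappaRhoFill_subset W ω hzK
        rcases hzim.lt_or_eq with hpos | hzero
        · exact Set.disjoint_left.1 hω hzK (hFA ⟨hzF, hpos⟩)
        · have hzx : z = ((z.re : ℝ) : ℂ) := Complex.ext (by simp) (by simp [← hzero])
          have hzJ : ((z.re : ℝ) : ℂ) ∈ J 0 := hzx ▸ (hJi ▸ iInter_subset J 0) hzF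
          have hxpos : 0 < z.re := (hJp 0).2 z.re hzJ
          have hnot : ((z.re : ℝ) : ℂ) ∉ sleKappaRhoFill W ω :=
            ofReal_notMem_leftFilling hxpos.le (hreal z.re hxpos)
          exact hnot (hzx ▸ hzK)
      -- the compact `K ∩ J 0` misses some `J n`
      have hC : IsCompact (sleKappaRhoFill W ω ∩ J 0) :=
        (hJp 0).1.isBoundedHull.isCompact.inter_left (isClosed_sleKappaRhoFill W ω)
      obtain ⟨n, hn⟩ := (eventually_disjoint_of_iInter_eq (fun n ↦ (hJp n).1.isBoundedHull.isClosed)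
        hJm hJi hC (hKF.mono_left inter_subset_left)).exists
      refine ⟨n, Set.disjoint_left.2 fun z hzK hzJ ↦ ?_⟩
      exact Set.disjoint_left.1 hn ⟨hzK, hJm (Nat.zero_le n) hzJ⟩ hzJ
    · rintro ⟨n, hn⟩
      exact hn.mono_right (hAF.trans (hJi ▸ iInter_subset J n))
  rw [measure_congr hae, hU]

end Assembly

end Literature.Probability.RandomPlanarGeometry

end
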